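import Mathlib.Algebra.MvPolynomial.Equiv
import Mathlib.Logic.Equiv.Fin.Rotate
import Mathlib.Data.Fintype.Pi
import Literature.ModelTheory.ExponentialFields.Semialgebraic
import Literature.ModelTheory.ExponentialFields.SignDiagram
import Literature.NumberTheory.Transcendental.SemialgebraicMaps
import HarnessLib

/-!
# The Tarski–Seidenberg projection theorem over `ℝ` (proof file)

Discharge of the named fact `Literature.ModelTheory.ExponentialFields.tarski_seidenberg_real` of
`Literature/ModelTheory/ExponentialFields/Semialgebraic.lean`: for every commutative coefficient
ring `k` with an algebra map `k → ℝ`, the image of a `k`-semialgebraic subset of `ℝ ^ (n + 1)`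
under the projection forgetting the last coordinate is `k`-semialgebraic
(Bochnak–Coste–Roy 1998, Thm. 2.2.1; Basu–Pollack–Roy 2006, Thm. 2.76, "projection theorem for
semi-algebraic sets defined over `D`"). The theorem `Literature.ModelTheory.ExponentialFields.tarski_seidenberg_real_holds` below has
literally the type `tarski_seidenberg_real (k := k)`; its axioms are the three standard ones.

## Proof architecture

1. *Sign-condition normal form* (`IsSemialgebraic.exists_eq_setOf_signVec_mem`): a
   `k`-semialgebraic set is `{x | (sign q(x))_{q ∈ Q} ∈ T}` for a finite family `Q` of polynomials
   over `k` and a set `T` of sign conditions on `Q` (induction over the generating Boolean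
   algebra); conversely such sets are semialgebraic (`isSemialgebraic_setOf_signVec_mem`).
2. *Elimination of the first variable* (`IsSemialgebraic.image_tail`): move `Q` into
   `A[X]`, `A = MvPolynomial (Fin n) k`, through `MvPolynomial.finSuccEquiv` (evaluation lemma
   `eval_map_finSuccEquiv`), enlarge it to a finite *stable* family `P`
   (`Literature.ModelTheory.ExponentialFields.SignDiagram.exists_isStable_supset`) and let `C` be the finite set of coefficients of
   members of `P`. By the parametric sign-diagram theorem
   (`Literature.ModelTheory.ExponentialFields.SignDiagram.exists_forall_sign_eval_map_eq`, the Cohen–Hörmander elimination proved in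
   `SignDiagram.lean`), two points `x, x' ∈ ℝ ^ n` giving the same signs to all members of `C` admit
   the same realizable sign conditions on `Q` in the fibre; hence the projection is the union of the
   sign-condition cells of `C` meeting it, a semialgebraic set — exactly the shape
   `⋃_{τ ∈ Σ} Reali(τ)` of Basu–Pollack–Roy's proof of Thm. 2.76.
3. *Last coordinate* (`tarski_seidenberg_real_holds`): the projection forgetting the last
   coordinate is the projection forgetting the first coordinate of the preimage under the cyclic
   rotation of coordinates (`image_init_eq_image_tail_preimage`, via `Fin.snoc_eq_cons_rotate`),
   and coordinate changes preserve semialgebraicity (`IsSemialgebraic.preimage_comp`).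

## References

* J. Bochnak, M. Coste, M.-F. Roy, *Real Algebraic Geometry*, Ergebnisse 36, Springer (1998),
  Thm. 2.2.1.
* S. Basu, R. Pollack, M.-F. Roy, *Algorithms in Real Algebraic Geometry*, 2nd ed., Springer
  (2006), Def. 2.25, §2.3, Thm. 2.62 (§2.3), Thm. 2.76 (§2.4).
-/

noncomputable section

namespace Literature.ModelTheory.ExponentialFields

open MvPolynomial

section SignConditions

variable {k : Type*} [CommRing k] [Algebra k ℝ]

/-- Sets cut out by one sign condition on one polynomial are semialgebraic. [folklore] -/
theorem isSemialgebraic_setOf_sign_aeval_eq {ι : Type*} (p : MvPolynomial ι k) (t : SignType) :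
    IsSemialgebraic k {x : ι → ℝ | SignType.sign (MvPolynomial.aeval x p) = t} := by
  rcases t with _ | _ | _
  · convert isSemialgebraic_setOf_eval_eq_zero (R := ℝ) p using 2 with x
    simp [sign_eq_zero_iff]
  · convert isSemialgebraic_setOf_eval_pos (R := ℝ) (-p) using 2 with x
    simp [sign_eq_neg_one_iff]
  · convert isSemialgebraic_setOf_eval_pos (R := ℝ) p using 2 with x
    simp [sign_eq_one_iff]

/-- Sets cut out by an arbitrary set of simultaneous sign conditions on a finite family of
polynomials are semialgebraic (a finite union of finite intersections of basic sign sets).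
[folklore] -/
theorem isSemialgebraic_setOf_signVec_mem {ι : Type*} (Q : Finset (MvPolynomial ι k))
    (T : Set (Q → SignType)) :
    IsSemialgebraic k {x : ι → ℝ |
      (fun q : Q => SignType.sign (MvPolynomial.aeval x (q : MvPolynomial ι k))) ∈ T} := by
  classical
  have hfin : T.Finite := Set.toFinite T
  have h1 :
      {x : ι → ℝ | (fun q : Q => SignType.sign (MvPolynomial.aeval x (q : MvPolynomial ι k))) ∈ T} =
      ⋃ t ∈ hfin.toFinset,
        {x | (fun q : Q => SignType.sign (MvPolynomial.aeval x (q : MvPolynomial ι k))) = t} := by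
    ext x; simp
  rw [h1]
  refine IsSemialgebraic.biUnion _ _ fun t _ => ?_
  have h2 :
      {x : ι → ℝ | (fun q : Q => SignType.sign (MvPolynomial.aeval x (q : MvPolynomial ι k))) = t} =
      ⋂ q ∈ (Finset.univ : Finset Q),
        {x | SignType.sign (MvPolynomial.aeval x (q : MvPolynomial ι k)) = t q} := by
    ext x; simp [funext_iff]
  rw [h2]
  exact IsSemialgebraic.biInter _ _ fun q _ => isSemialgebraic_setOf_sign_aeval_eq _ _

/-- **Sign-condition normal form.** Every `k`-semialgebraic set is the set of points realizing one
of a set of simultaneous sign conditions on a finite family of polynomials over `k`.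
[cite: BasuPollackRoy2006, Def. 2.25 (sign conditions, Reali(σ)) and §2.3 (basic s.a. sets)] -/
theorem IsSemialgebraic.exists_eq_setOf_signVec_mem {ι : Type*} {s : Set (ι → ℝ)}
    (hs : IsSemialgebraic k s) :
    ∃ (Q : Finset (MvPolynomial ι k)) (T : Set (Q → SignType)),
      s = {x | (fun q : Q => SignType.sign (MvPolynomial.aeval x (q : MvPolynomial ι k))) ∈ T} := by
  classical
  induction hs using BooleanSubalgebra.closure_bot_sup_induction with
  | mem t ht =>
    rcases ht with ⟨p, rfl⟩ | ⟨p, rfl⟩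
    · refine ⟨{p}, {σ | σ ⟨p, Finset.mem_singleton_self p⟩ = 0}, ?_⟩
      ext x; simp [sign_eq_zero_iff]
    · refine ⟨{p}, {σ | σ ⟨p, Finset.mem_singleton_self p⟩ = 1}, ?_⟩
      ext x; simp [sign_eq_one_iff]
  | bot => exact ⟨∅, ∅, by simp⟩
  | sup t _ u _ iht ihu =>
    obtain ⟨Q₁, T₁, rfl⟩ := iht
    obtain ⟨Q₂, T₂, rfl⟩ := ihu
    refine ⟨Q₁ ∪ Q₂, {σ | (fun q : Q₁ => σ ⟨q, Finset.mem_union_left _ q.2⟩) ∈ T₁ ∨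
      (fun q : Q₂ => σ ⟨q, Finset.mem_union_right _ q.2⟩) ∈ T₂}, ?_⟩
    ext x
    simp only [Set.sup_eq_union, Set.mem_union, Set.mem_setOf_eq]
  | compl t _ iht =>
    obtain ⟨Q, T, rfl⟩ := iht
    exact ⟨Q, Tᶜ, by ext x; simp⟩

end SignConditions

section Projection

variable {k : Type*} [CommRing k] [Algebra k ℝ] {n : ℕ}

/-- Evaluation in two stages: singling out the variable `0` via `MvPolynomial.finSuccEquiv`,
specializing the remaining variables at `x`, then evaluating at `y`, is evaluation at
`Fin.cons y x`. [folklore] -/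
theorem eval_map_finSuccEquiv (x : Fin n → ℝ) (y : ℝ) (F : MvPolynomial (Fin (n + 1)) k) :
    ((finSuccEquiv k n F).map (MvPolynomial.eval₂Hom (algebraMap k ℝ) x)).eval y =
      MvPolynomial.aeval (Fin.cons y x : Fin (n + 1) → ℝ) F := by
  induction F using MvPolynomial.induction_on with
  | C a => simp [finSuccEquiv_apply]
  | add p q hp hq => simp only [map_add, Polynomial.map_add, Polynomial.eval_add, hp, hq]
  | mul_X p i hp =>
    simp only [map_mul, Polynomial.map_mul, Polynomial.eval_mul, hp, MvPolynomial.aeval_X]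
    congr 1
    refine Fin.cases ?_ (fun j => ?_) i
    · simp [finSuccEquiv_X_zero]
    · simp [finSuccEquiv_X_succ]

/-- **Tarski–Seidenberg, projection along the first coordinate.** The image of a
`k`-semialgebraic subset of `ℝ ^ (n + 1)` under `v ↦ (v 1, …, v n)` is `k`-semialgebraic.
Proof: write `s` by sign conditions on a finite family `Q`; embed `Q` in a finite stable family
`P ⊆ A[X]`, `A = k[X₁, …, Xₙ]`; by the parametric sign-diagram theorem the set of sign conditions
on `Q` realizable over `x` only depends on the signs at `x` of the (finitely many) coefficients of
the members of `P`, so the projection is a union of sign-condition cells of those coefficients.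
[cite: BasuPollackRoy2006, Thm. 2.76 (§2.4); proof of Thm. 2.62 (projection = ⋃_{τ ∈ Σ} Reali(τ))]
-/
theorem IsSemialgebraic.image_tail {s : Set (Fin (n + 1) → ℝ)} (hs : IsSemialgebraic k s) :
    IsSemialgebraic k ((fun v : Fin (n + 1) → ℝ => fun i : Fin n => v i.succ) '' s) := by
  classical
  obtain ⟨Q, T, rfl⟩ := hs.exists_eq_setOf_signVec_mem
  obtain ⟨P, hQP, hP⟩ :=
    SignDiagram.exists_isStable_supset (Q.image fun q => finSuccEquiv k n q)
  set C : Finset (MvPolynomial (Fin n) k) := P.biUnion fun f => f.coeffs with hC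
  set π : (Fin (n + 1) → ℝ) → (Fin n → ℝ) := fun v i => v i.succ with hπ
  set s : Set (Fin (n + 1) → ℝ) :=
    {x | (fun q : Q => SignType.sign (MvPolynomial.aeval x (q : MvPolynomial (Fin (n + 1)) k))) ∈ T}
    with hs
  set τ : (Fin n → ℝ) → (C → SignType) :=
    fun x c => SignType.sign (MvPolynomial.aeval x (c : MvPolynomial (Fin n) k)) with hτ
  have key : π '' s = {x | τ x ∈ τ '' (π '' s)} := by
    refine Set.Subset.antisymm (fun x hx => Set.mem_image_of_mem τ hx) ?_
    rintro x' ⟨x, ⟨v, hv, rfl⟩, hxx'⟩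
    set φ : MvPolynomial (Fin n) k →+* ℝ := MvPolynomial.eval₂Hom (algebraMap k ℝ) (π v) with hφ
    set ψ : MvPolynomial (Fin n) k →+* ℝ := MvPolynomial.eval₂Hom (algebraMap k ℝ) x' with hψ
    have hsign : ∀ f ∈ P, ∀ i,
        SignType.sign (φ (f.coeff i)) = SignType.sign (ψ (f.coeff i)) := by
      intro f hf i
      by_cases h0 : f.coeff i = 0
      · simp [h0]
      · have hc : f.coeff i ∈ C := Finset.mem_biUnion.mpr ⟨f, hf, Polynomial.coeff_mem_coeffs h0⟩
        exact congr_fun hxx' ⟨_, hc⟩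
    obtain ⟨y', hy'⟩ := SignDiagram.exists_forall_sign_eval_map_eq φ ψ P hP hsign (v 0)
    refine ⟨Fin.cons y' x', ?_, ?_⟩
    · show (fun q : Q => SignType.sign (MvPolynomial.aeval (Fin.cons y' x' : Fin (n + 1) → ℝ)
        (q : MvPolynomial (Fin (n + 1)) k))) ∈ T
      have hv' : (fun q : Q => SignType.sign (MvPolynomial.aeval (Fin.cons y' x' : Fin (n + 1) → ℝ)
          (q : MvPolynomial (Fin (n + 1)) k))) =
          fun q : Q => SignType.sign (MvPolynomial.aeval v (q : MvPolynomial (Fin (n + 1)) k)) := by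
        have hπv : (Fin.cons (v 0) (π v) : Fin (n + 1) → ℝ) = v := Fin.cons_self_tail v
        funext q
        have hqP : finSuccEquiv k n q ∈ P := hQP (Finset.mem_image_of_mem _ q.2)
        rw [← eval_map_finSuccEquiv x' y' (q : MvPolynomial (Fin (n + 1)) k), ← hy' _ hqP,
          eval_map_finSuccEquiv (π v) (v 0) (q : MvPolynomial (Fin (n + 1)) k), hπv]
      rw [hv']
      exact hv
    · funext i
      simp [hπ]
  rw [key]
  exact isSemialgebraic_setOf_signVec_mem C _

/-- The projection forgetting the last coordinate is the projection forgetting the first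
coordinate of the preimage under the cyclic rotation of coordinates. [folklore] -/
theorem image_init_eq_image_tail_preimage (s : Set (Fin (n + 1) → ℝ)) :
    (fun v : Fin (n + 1) → ℝ => v ∘ Fin.castSucc) '' s =
      (fun w : Fin (n + 1) → ℝ => fun i : Fin n => w i.succ) ''
        ((fun w : Fin (n + 1) → ℝ => w ∘ (finRotate (n + 1))) ⁻¹' s) := by
  have hrot : ∀ i : Fin n, finRotate (n + 1) (Fin.castSucc i) = i.succ := fun i =>
    Fin.ext (by rw [coe_finRotate_of_ne_last (Fin.castSucc_lt_last i).ne, Fin.val_castSucc,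
      Fin.val_succ])
  ext u
  simp only [Set.mem_image, Set.mem_preimage]
  constructor
  · rintro ⟨v, hv, rfl⟩
    refine ⟨Fin.cons (v (Fin.last n)) (v ∘ Fin.castSucc), ?_, ?_⟩
    · have h1 : (Fin.cons (v (Fin.last n)) (v ∘ Fin.castSucc) : Fin (n + 1) → ℝ) ∘
          (finRotate (n + 1)) = Fin.snoc (v ∘ Fin.castSucc) (v (Fin.last n)) := by
        rw [Fin.snoc_eq_cons_rotate]; rfl
      rw [h1]
      convert hv using 1
      exact Fin.snoc_init_self v
    · funext i; simp
  · rintro ⟨w, hw, rfl⟩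
    refine ⟨w ∘ finRotate (n + 1), hw, ?_⟩
    funext i
    simp only [Function.comp_apply, hrot]

/-- **Tarski–Seidenberg theorem over `ℝ`** (discharge of the named fact
`Literature.ModelTheory.ExponentialFields.tarski_seidenberg_real`): the image of a `k`-semialgebraic subset of `ℝ ^ (n + 1)` under the
projection forgetting the last coordinate is `k`-semialgebraic, for every coefficient ring `k`.
Reduced to the projection along the first coordinate by a cyclic rotation of coordinates.
[cite: BochnakCosteRoy1998, Thm. 2.2.1] [cite: BasuPollackRoy2006, Thm. 2.76] -/
theorem tarski_seidenberg_real_holds : tarski_seidenberg_real (k := k) := by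
  intro n s hs
  rw [image_init_eq_image_tail_preimage]
  exact (hs.preimage_comp _).image_tail

end Projection

end Literature.ModelTheory.ExponentialFields

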